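import Summits.AtomisticToContinuum.Crystallization.Theorems.PalmUnimodularRigidityLayeredLawsSelectHcpLineSecondDiff
import Summits.AtomisticToContinuum.Crystallization.Theorems.PalmUnimodularRigidityLayeredLawsSelectHcpArcChord

/-!
# In-layer range floors of rooted charts from single-star straightness
(stub `tube_farRangeInLayer` of line `mtp-prestress-split-ergodic-frame`, crux `LayeredLawsSelectHcp`,
stmt-AtomisticToContinuum-9226)

The far field of the rigidity certificate needs explicit LOWER bounds for the distance from the root to far
chart labels (`Cruxes/LayeredLawsSelectHcp/LeadC3FarField.md`).  Here: the labels of the root's own layer.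
Such a label is `n₁ • e + n₂ • e'` with `e, e'` two ADJACENT in-layer star labels (`⟪ê, ê'⟫ = 1/2` for the
ideal unit struts `ê = hcpSite 1 √(2/3) e`, `ê'`), and it is reached from the root by the L-shaped lattice
path of `n₁` steps `e` followed by `n₂` steps `e'`.  For a rooted labelled chart `X` of an every-point-good
hcp-charted `S ∋ 0` we read the path backwards from the corner `c = n₁ • e`: `P t = X (c + t • (−e))`
(`P 0 = X c`, `P n₁ = X 0 = 0`) and `Q t = X (c + t • e')` (`Q 0 = X c`, `Q n₂` the target atom), so that
`X (n₁ • e + n₂ • e') = u + v` with `u = X c = ∑ (P i − P (i+1))` and `v = Q n₂ − Q 0 = ∑ (Q (j+1) − Q j)`,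
and `‖u + v‖² = ‖u‖² + 2⟪u, v⟫ + ‖v‖²`.

* In the root layer every label is even, so `labelShift w v = w + v` (`farIn_labelShift`); the star of
  `reRoot X w` is fitted within `a_w/100` by one frame `(a_w, A_w)`, `a_w ∈ [9/10, 1]`
  (`exists_frame_reRoot`), whence every in-layer bond has length in `[891/1000, 101/100]` (`farIn_bond`),
  consecutive bonds of a lattice line differ by `≤ 1/50` (`tube_lineSecondDiff`, `farIn_secondDiff`), and at
  the corner the incoming bond `X c − X (c − e) ≈ a A ê` and the outgoing bond `X (c + e') − X c ≈ a A ê'`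
  sit in the SAME frame, so their inner product is `≥ a² (1/2 − 2/100 − 1/10000) ≥ 3843/10000`
  (`farIn_inner_ge_of_fit`, `farIn_corner`; `⟪A ê, A ê'⟫ = ⟪ê, ê'⟫ = 1/2`).
* Blocks: `‖u‖² ≥ 0.891² n₁² − n₁²(n₁² − 1)/30000` and the same for `v` — the landed discrete arc–chord
  inequality `tube_arcChord_of_secondDiff` (`κ = 1/50`, `κ²/12 = 1/30000`).
* Cross term: `⟪P i − P (i+1), Q (j+1) − Q j⟫ ≥ 3843/10000 − (101/100)(1/50)(i + j)` (corner pair plus two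
  chain corrections, Cauchy–Schwarz), summed in closed form (`farIn_cross_sum_bound`,
  `farIn_sum_sum_affine`): `2⟪u, v⟫ ≥ (3843/5000) n₁ n₂ − (101/5000) n₁ n₂ (n₁ + n₂ − 2)`.

Adding up gives the registered polynomial floor `tube_farRangeInLayer` (with room to spare).  All `[folklore]`.
-/

noncomputable section

namespace Summit.AtomisticToContinuum.Crystallization.Theorems.PalmUnimodularRigidity.LayeredLawsSelectHcp

open MeasureTheory Set
open Literature.MathematicalPhysics.StatisticalMechanics Literature.Geometry.DiscreteGeometry
open Summit.AtomisticToContinuum.Crystallization.Theorems.LayeredLawsSelectHcp.Negative.DiracLaws (GoodShell)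
open scoped RealInnerProductSpace

/-! ## Two elementary sums -/

/-- `∑_{i<n} (α + β i) = n α + β · n(n − 1)/2`. [folklore] -/
theorem farIn_sum_range_affine (α β : ℝ) : ∀ n : ℕ,
    ∑ i ∈ Finset.range n, (α + β * i) = n * α + β * ((n : ℝ) * ((n : ℝ) - 1) / 2)
  | 0 => by simp
  | n + 1 => by
    rw [Finset.sum_range_succ, farIn_sum_range_affine α β n]
    push_cast
    ring

/-- The closed form of the affine minorant of the cross inner products:
`∑_{i<n} ∑_{j<m} (C − μ i − μ j) = n m C − μ · n m (n + m − 2)/2`. [folklore] -/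
theorem farIn_sum_sum_affine (C μ : ℝ) (n m : ℕ) :
    ∑ i ∈ Finset.range n, ∑ j ∈ Finset.range m, (C - μ * i - μ * j) =
      (n : ℝ) * m * C - μ * ((n : ℝ) * m * ((n : ℝ) + m - 2) / 2) := by
  have h1 : ∀ i : ℕ, ∑ j ∈ Finset.range m, (C - μ * i - μ * j) =
      ((m : ℝ) * C - μ * ((m : ℝ) * ((m : ℝ) - 1) / 2)) + (-(μ * m)) * i := by
    intro i
    calc ∑ j ∈ Finset.range m, (C - μ * i - μ * j)
        = ∑ j ∈ Finset.range m, ((C - μ * i) + (-μ) * j) := Finset.sum_congr rfl fun j _ => by ring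
      _ = m * (C - μ * i) + (-μ) * ((m : ℝ) * ((m : ℝ) - 1) / 2) := farIn_sum_range_affine _ _ m
      _ = ((m : ℝ) * C - μ * ((m : ℝ) * ((m : ℝ) - 1) / 2)) + (-(μ * m)) * i := by ring
  rw [Finset.sum_congr rfl fun i _ => h1 i, farIn_sum_range_affine]
  ring

/-! ## Two inner-product estimates -/

/-- **Inner product of two fitted vectors.**  `‖p − f‖ ≤ η` and `‖q − g‖ ≤ η` give
`⟪p, q⟫ ≥ ⟪f, g⟫ − η ‖g‖ − η ‖f‖ − η²` (expand `⟪f + (p − f), g + (q − g)⟫`, Cauchy–Schwarz). [folklore] -/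
theorem farIn_inner_ge_of_fit {V : Type*} [NormedAddCommGroup V] [InnerProductSpace ℝ V] {p q f g : V}
    {η : ℝ} (hη : 0 ≤ η) (hp : ‖p - f‖ ≤ η) (hq : ‖q - g‖ ≤ η) :
    ⟪f, g⟫ - η * ‖g‖ - η * ‖f‖ - η ^ 2 ≤ ⟪p, q⟫ := by
  have e : ⟪p, q⟫ = ⟪f, g⟫ + ⟪p - f, g⟫ + ⟪f, q - g⟫ + ⟪p - f, q - g⟫ := by
    simp only [inner_sub_left, inner_sub_right]; ring
  have h1 := (abs_le.1 (abs_real_inner_le_norm (p - f) g)).1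
  have h2 := (abs_le.1 (abs_real_inner_le_norm f (q - g))).1
  have h3 := (abs_le.1 (abs_real_inner_le_norm (p - f) (q - g))).1
  have k1 : ‖p - f‖ * ‖g‖ ≤ η * ‖g‖ := mul_le_mul_of_nonneg_right hp (norm_nonneg _)
  have k2 : ‖f‖ * ‖q - g‖ ≤ ‖f‖ * η := mul_le_mul_of_nonneg_left hq (norm_nonneg _)
  have k3 : ‖p - f‖ * ‖q - g‖ ≤ η * η := mul_le_mul hp hq (norm_nonneg _) hη
  rw [e]
  nlinarith [h1, h2, h3, k1, k2, k3]

/-- **The cross inner products of an L-shaped bond chain.**  Two chains of bonds `F i` (`i < n`) and `G j`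
(`j < m`) of lengths `≤ M`, each with consecutive differences `≤ κ`, meeting at a corner with
`⟪F 0, G 0⟫ ≥ C`, have `⟪∑ F i, ∑ G j⟫ ≥ n m C − M κ · n m (n + m − 2)/2`: indeed
`⟪F i, G j⟫ = ⟪F 0, G 0⟫ + ⟪F i − F 0, G j⟫ + ⟪F 0, G j − G 0⟫ ≥ C − M κ i − M κ j` by the chain bound
`‖F i − F 0‖ ≤ κ i` (`arcChord_chain_bound`) and Cauchy–Schwarz. [folklore] -/
theorem farIn_cross_sum_bound {V : Type*} [NormedAddCommGroup V] [InnerProductSpace ℝ V] (F G : ℕ → V)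
    (n m : ℕ) {M κ C : ℝ} (hM : 0 ≤ M) (hκ : 0 ≤ κ) (hF : ∀ i, i < n → ‖F i‖ ≤ M)
    (hG : ∀ j, j < m → ‖G j‖ ≤ M) (hFd : ∀ t, 0 < t → t < n → ‖F t - F (t - 1)‖ ≤ κ)
    (hGd : ∀ t, 0 < t → t < m → ‖G t - G (t - 1)‖ ≤ κ) (hC : 0 < n → 0 < m → C ≤ ⟪F 0, G 0⟫) :
    (n : ℝ) * m * C - M * κ * ((n : ℝ) * m * ((n : ℝ) + m - 2) / 2) ≤
      ⟪∑ i ∈ Finset.range n, F i, ∑ j ∈ Finset.range m, G j⟫ := by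
  rw [sum_inner]
  simp_rw [inner_sum]
  rw [← farIn_sum_sum_affine C (M * κ) n m]
  refine Finset.sum_le_sum fun i hi => Finset.sum_le_sum fun j hj => ?_
  rw [Finset.mem_range] at hi hj
  have hn : 0 < n := by omega
  have hm : 0 < m := by omega
  have e : ⟪F i, G j⟫ = ⟪F 0, G 0⟫ + ⟪F i - F 0, G j⟫ + ⟪F 0, G j - G 0⟫ := by
    simp only [inner_sub_left, inner_sub_right]; ring
  have hdF : ‖F i - F 0‖ ≤ κ * i := by
    have := arcChord_chain_bound F κ n hFd 0 i (by simpa using hi)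
    simpa using this
  have hdG : ‖G j - G 0‖ ≤ κ * j := by
    have := arcChord_chain_bound G κ m hGd 0 j (by simpa using hj)
    simpa using this
  have h1 := (abs_le.1 (abs_real_inner_le_norm (F i - F 0) (G j))).1
  have h2 := (abs_le.1 (abs_real_inner_le_norm (F 0) (G j - G 0))).1
  have k1 : ‖F i - F 0‖ * ‖G j‖ ≤ κ * i * M :=
    mul_le_mul hdF (hG j hj) (norm_nonneg _) (mul_nonneg hκ (Nat.cast_nonneg _))
  have k2 : ‖F 0‖ * ‖G j - G 0‖ ≤ M * (κ * j) := mul_le_mul (hF 0 hn) hdG (norm_nonneg _) hM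
  have h0 := hC hn hm
  rw [e]
  linarith

/-- **Assembly along an L-shaped path.**  Two discrete paths `P` (read from the corner `P 0` back to
`P n₁ = 0`) and `Q` (from the corner `Q 0 = P 0` on), with bonds of length in `[891/1000, 101/100]`, second
differences `≤ 1/50` and corner inner product `⟪P 0 − P 1, Q 1 − Q 0⟫ ≥ 3843/10000`, end at
`‖Q n₂‖² ≥ 0.7921 (n₁² + n₂²) + 0.7686 n₁ n₂ − (n₁²(n₁² − 1) + n₂²(n₂² − 1))/30000 − 0.0202 n₁ n₂ (n₁ + n₂)`:
`Q n₂ = P 0 + (Q n₂ − Q 0)`, the two blocks by `tube_arcChord_of_secondDiff`, the cross term by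
`farIn_cross_sum_bound` after telescoping. [folklore] -/
theorem farIn_assemble (P Q : ℕ → EuclideanSpace ℝ (Fin 3)) (n₁ n₂ : ℕ) (hPn : P n₁ = 0) (hPQ : P 0 = Q 0)
    (hPb : ∀ t, 891 / 1000 ≤ ‖P (t + 1) - P t‖ ∧ ‖P (t + 1) - P t‖ ≤ 101 / 100)
    (hPdd : ∀ t, 0 < t → ‖P (t + 1) - (2 : ℝ) • P t + P (t - 1)‖ ≤ 1 / 50)
    (hQb : ∀ t, 891 / 1000 ≤ ‖Q (t + 1) - Q t‖ ∧ ‖Q (t + 1) - Q t‖ ≤ 101 / 100)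
    (hQdd : ∀ t, 0 < t → ‖Q (t + 1) - (2 : ℝ) • Q t + Q (t - 1)‖ ≤ 1 / 50)
    (hcorner : 0 < n₁ → 0 < n₂ → 3843 / 10000 ≤ ⟪P 0 - P 1, Q 1 - Q 0⟫) :
    (7921 / 10000 : ℝ) * ((n₁ : ℝ) ^ 2 + (n₂ : ℝ) ^ 2) + (3843 / 5000 : ℝ) * n₁ * n₂ -
        ((n₁ : ℝ) ^ 2 * ((n₁ : ℝ) ^ 2 - 1) + (n₂ : ℝ) ^ 2 * ((n₂ : ℝ) ^ 2 - 1)) / 30000 -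
        (101 / 5000 : ℝ) * n₁ * n₂ * ((n₁ : ℝ) + n₂) ≤ ‖Q n₂‖ ^ 2 := by
  -- the two blocks
  have hA := tube_arcChord_of_secondDiff n₁ P (891 / 1000) (1 / 50) (by norm_num) (by norm_num)
    (fun t _ => (hPb t).1) (fun t ht _ => hPdd t ht)
  have hB := tube_arcChord_of_secondDiff n₂ Q (891 / 1000) (1 / 50) (by norm_num) (by norm_num)
    (fun t _ => (hQb t).1) (fun t ht _ => hQdd t ht)
  rw [hPn, zero_sub, norm_neg] at hA
  -- the cross term
  have hFd : ∀ t, 0 < t → t < n₁ → ‖(P t - P (t + 1)) - (P (t - 1) - P (t - 1 + 1))‖ ≤ 1 / 50 := by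
    intro t ht _
    rw [Nat.sub_add_cancel ht]
    have e3 : (P t - P (t + 1)) - (P (t - 1) - P t) = -(P (t + 1) - (2 : ℝ) • P t + P (t - 1)) := by
      rw [two_smul]; abel
    rw [e3, norm_neg]
    exact hPdd t ht
  have hGd : ∀ t, 0 < t → t < n₂ → ‖(Q (t + 1) - Q t) - (Q (t - 1 + 1) - Q (t - 1))‖ ≤ 1 / 50 := by
    intro t ht _
    rw [Nat.sub_add_cancel ht]
    have e3 : (Q (t + 1) - Q t) - (Q t - Q (t - 1)) = Q (t + 1) - (2 : ℝ) • Q t + Q (t - 1) := by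
      rw [two_smul]; abel
    rw [e3]
    exact hQdd t ht
  have hC := farIn_cross_sum_bound (fun i => P i - P (i + 1)) (fun j => Q (j + 1) - Q j) n₁ n₂
    (M := 101 / 100) (κ := 1 / 50) (C := 3843 / 10000) (by norm_num) (by norm_num)
    (fun i _ => by rw [norm_sub_rev]; exact (hPb i).2) (fun j _ => (hQb j).2) hFd hGd hcorner
  rw [Finset.sum_range_sub' P n₁, Finset.sum_range_sub Q n₂, hPn, sub_zero] at hC
  -- assembly
  have hsq : ‖Q n₂‖ ^ 2 = ‖P 0‖ ^ 2 + 2 * ⟪P 0, Q n₂ - Q 0⟫ + ‖Q n₂ - Q 0‖ ^ 2 := by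
    rw [← norm_add_sq_real, hPQ, add_sub_cancel]
  rw [hsq]
  have hn1 : (0 : ℝ) ≤ n₁ := Nat.cast_nonneg _
  have hn2 : (0 : ℝ) ≤ n₂ := Nat.cast_nonneg _
  nlinarith [mul_nonneg hn1 hn2, sq_nonneg (n₁ : ℝ), sq_nonneg (n₂ : ℝ), hA, hB, hC]

/-! ## Bonds of a rooted chart in the root layer -/

/-- In the root layer (an even layer) the label transport is the translation. [folklore] -/
theorem farIn_labelShift {w : ℤ × ℤ × ℤ} (hw : w.1 = 0) (v : ℤ × ℤ × ℤ) : labelShift w v = w + v := by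
  have hev : Even w.1 := by rw [hw]; exact Even.zero
  unfold labelShift
  rw [if_pos hev]

variable {S : Set (EuclideanSpace ℝ (Fin 3))} {X : ℤ × ℤ × ℤ → EuclideanSpace ℝ (Fin 3)}

/-- **In-layer bonds have length in `[891/1000, 101/100]`.**  At a root-layer label `w` the bond
`X (w + v) − X w = reRoot X w v` (`v` a star label) is within `a_w/100` of `a_w • A_w (hcpSite 1 √(2/3) v)`,
of norm `a_w ∈ [9/10, 1]` (`exists_frame_reRoot`, `norm_ideal_strut`). [folklore] -/
theorem farIn_bond (hgood : ∀ x ∈ S, GoodShell S x) (hch : HcpCharted S) (hX : IsRootedChart S X)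
    {w v : ℤ × ℤ × ℤ} (hw : w.1 = 0) (hv : v ∈ hcpStarIdx) :
    891 / 1000 ≤ ‖X (w + v) - X w‖ ∧ ‖X (w + v) - X w‖ ≤ 101 / 100 := by
  obtain ⟨a, h9, h1, A, hA⟩ := exists_frame_reRoot hgood hch hX w
  have hp := hA v hv
  simp only [reRoot, farIn_labelShift hw] at hp
  have hn : ‖a • A (hcpSite 1 (Real.sqrt (2 / 3)) v)‖ = a := by
    rw [norm_smul, LinearIsometryEquiv.norm_map, norm_ideal_strut hv, mul_one,
      Real.norm_of_nonneg (by linarith)]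
  have h3 := abs_norm_sub_norm_le (X (w + v) - X w) (a • A (hcpSite 1 (Real.sqrt (2 / 3)) v))
  rw [hn] at h3
  obtain ⟨hl, hu⟩ := abs_le.1 (h3.trans hp)
  constructor <;> linarith

/-- **Lattice lines are straight to second order** (`tube_lineSecondDiff` read in the root layer):
`‖X (w + e) − 2 • X w + X (w − e)‖ ≤ 1/50` for an in-layer star label `e`. [folklore] -/
theorem farIn_secondDiff (h0 : (0 : EuclideanSpace ℝ (Fin 3)) ∈ S) (hgood : ∀ x ∈ S, GoodShell S x)
    (hch : HcpCharted S) (hX : IsRootedChart S X) {w e : ℤ × ℤ × ℤ} (hw : w.1 = 0)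
    (he : e ∈ hcpStarIdx) (he0 : e.1 = 0) :
    ‖X (w + e) - (2 : ℝ) • X w + X (w + -e)‖ ≤ 1 / 50 := by
  have h := tube_lineSecondDiff S X h0 hgood hch hX w e he he0
  rw [farIn_labelShift hw, farIn_labelShift hw] at h
  have e3 : X (w + e) - (2 : ℝ) • X w + X (w + -e) = X (w + e) + X (w + -e) - (2 : ℝ) • X w := by abel
  rw [e3]
  exact h

/-- **The corner.**  At a root-layer label `w`, for in-layer star labels `e, e'` with `⟪ê, ê'⟫ = 1/2`
(`ê = hcpSite 1 √(2/3) e`), the incoming bond `X w − X (w − e)` and the outgoing bond `X (w + e') − X w`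
have inner product `≥ 3843/10000`: both are fitted within `a/100` by the SAME frame `(a, A)` at `w`
(`exists_frame_reRoot`; `−e` is a star label with `hcpSite … (−e) = −hcpSite … e`,
`StrictSplittingRuleBirth.h1_neg_of_even`), to `a • A ê` and `a • A ê'`, and
`⟪a • A ê, a • A ê'⟫ = a²/2` (`A` a linear isometry), so `farIn_inner_ge_of_fit` gives
`≥ a² (1/2 − 2/100 − 1/10000) ≥ (81/100)(4799/10000)`. [folklore] -/
theorem farIn_corner (hgood : ∀ x ∈ S, GoodShell S x) (hch : HcpCharted S) (hX : IsRootedChart S X)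
    {w e e' : ℤ × ℤ × ℤ} (hw : w.1 = 0) (he : e ∈ hcpStarIdx) (he' : e' ∈ hcpStarIdx) (he0 : e.1 = 0)
    (hi : ⟪hcpSite 1 (Real.sqrt (2 / 3)) e, hcpSite 1 (Real.sqrt (2 / 3)) e'⟫ = 1 / 2) :
    3843 / 10000 ≤ ⟪X w - X (w + -e), X (w + e') - X w⟫ := by
  obtain ⟨a, h9, h1, A, hA⟩ := exists_frame_reRoot hgood hch hX w
  have hp := hA (-e) (neg_mem_hcpStarIdx he he0)
  have hq := hA e' he'
  have hev : Even e.1 := by rw [he0]; exact Even.zero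
  rw [StrictSplittingRuleBirth.h1_neg_of_even _ _ hev, map_neg, smul_neg, sub_neg_eq_add] at hp
  simp only [reRoot, farIn_labelShift hw] at hp hq
  have hp' : ‖(X w - X (w + -e)) - a • A (hcpSite 1 (Real.sqrt (2 / 3)) e)‖ ≤ a / 100 := by
    rw [show (X w - X (w + -e)) - a • A (hcpSite 1 (Real.sqrt (2 / 3)) e) =
        -(X (w + -e) - X w + a • A (hcpSite 1 (Real.sqrt (2 / 3)) e)) by abel, norm_neg]
    exact hp
  have key := farIn_inner_ge_of_fit (by linarith : 0 ≤ a / 100) hp' hq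
  rw [real_inner_smul_left, real_inner_smul_right, LinearIsometryEquiv.inner_map_map, hi, norm_smul,
    norm_smul, LinearIsometryEquiv.norm_map, LinearIsometryEquiv.norm_map, norm_ideal_strut he,
    norm_ideal_strut he', Real.norm_of_nonneg (by linarith : (0 : ℝ) ≤ a)] at key
  have ha2 : (9 / 10 : ℝ) * (9 / 10) ≤ a * a := mul_le_mul h9 h9 (by norm_num) (by linarith)
  nlinarith [key, ha2]

/-- **A lattice line of the root layer, read through the chart.**  For a root-layer label `w₀` and an
in-layer star label `d`, the path `t ↦ X (w₀ + t • d)` has bonds of length in `[891/1000, 101/100]`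
(`farIn_bond`) and second differences `≤ 1/50` (`farIn_secondDiff`). [folklore] -/
theorem farIn_line (h0 : (0 : EuclideanSpace ℝ (Fin 3)) ∈ S) (hgood : ∀ x ∈ S, GoodShell S x)
    (hch : HcpCharted S) (hX : IsRootedChart S X) {w₀ d : ℤ × ℤ × ℤ} (hw₀ : w₀.1 = 0)
    (hd : d ∈ hcpStarIdx) (hd0 : d.1 = 0) :
    (∀ t : ℕ, 891 / 1000 ≤ ‖X (w₀ + ((t + 1 : ℕ) : ℤ) • d) - X (w₀ + (t : ℤ) • d)‖ ∧
        ‖X (w₀ + ((t + 1 : ℕ) : ℤ) • d) - X (w₀ + (t : ℤ) • d)‖ ≤ 101 / 100) ∧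
      ∀ t : ℕ, 0 < t → ‖X (w₀ + ((t + 1 : ℕ) : ℤ) • d) - (2 : ℝ) • X (w₀ + (t : ℤ) • d) +
        X (w₀ + ((t - 1 : ℕ) : ℤ) • d)‖ ≤ 1 / 50 := by
  have hw : ∀ t : ℕ, (w₀ + (t : ℤ) • d).1 = 0 := fun t => by simp [hw₀, hd0]
  constructor
  · intro t
    have e1 : w₀ + ((t + 1 : ℕ) : ℤ) • d = (w₀ + (t : ℤ) • d) + d := by push_cast; module
    rw [e1]
    exact farIn_bond hgood hch hX (hw t) hd
  · intro t ht
    obtain ⟨s, rfl⟩ : ∃ s, t = s + 1 := ⟨t - 1, (Nat.sub_add_cancel ht).symm⟩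
    have e1 : w₀ + ((s + 1 + 1 : ℕ) : ℤ) • d = (w₀ + ((s + 1 : ℕ) : ℤ) • d) + d := by
      push_cast; module
    have e2 : w₀ + ((s + 1 - 1 : ℕ) : ℤ) • d = (w₀ + ((s + 1 : ℕ) : ℤ) • d) + -d := by
      rw [Nat.add_sub_cancel]; push_cast; module
    rw [e1, e2]
    exact farIn_secondDiff h0 hgood hch hX (hw (s + 1)) hd hd0

/-! ## The registered stub -/

/-- **Registered sub-goal `tube_farRangeInLayer`: in-layer far labels stay far, quantitatively.**  For an
every-point-good hcp-charted `S ∋ 0`, a rooted labelled chart `X` of `S`, two adjacent in-layer star labels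
`e, e'` (`⟪hcpSite 1 √(2/3) e, hcpSite 1 √(2/3) e'⟫ = 1/2`) and `n₁, n₂ : ℕ`,
`‖X (n₁ • e + n₂ • e')‖² ≥ 0.7921 (n₁² + n₂²) + 0.7686 n₁ n₂ − (n₁²(n₁² − 1) + n₂²(n₂² − 1))/30000
 − 0.0202 n₁ n₂ (n₁ + n₂)`: `farIn_assemble` for the chart read along the L-shaped lattice path through the
corner `c = n₁ • e` (`P t = X (c + t • (−e))`, `Q t = X (c + t • e')`, `farIn_line`, `farIn_corner`).
[folklore] -/
theorem tube_farRangeInLayer : ∀ S : Set (EuclideanSpace ℝ (Fin 3)), ∀ X : ℤ × ℤ × ℤ → EuclideanSpace ℝ (Fin 3), (0 : EuclideanSpace ℝ (Fin 3)) ∈ S → (∀ x ∈ S, GoodShell S x) → HcpCharted S → IsRootedChart S X → ∀ e e' : ℤ × ℤ × ℤ, e ∈ hcpStarIdx → e' ∈ hcpStarIdx → e.1 = 0 → e'.1 = 0 → inner ℝ (hcpSite 1 (Real.sqrt (2 / 3)) e) (hcpSite 1 (Real.sqrt (2 / 3)) e') = 1 / 2 → ∀ n₁ n₂ : ℕ,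 (7921 / 10000 : ℝ) * ((n₁ : ℝ) ^ 2 + (n₂ : ℝ) ^ 2) + (3843 / 5000 : ℝ) * n₁ * n₂ - ((n₁ : ℝ) ^ 2 * ((n₁ : ℝ) ^ 2 - 1) + (n₂ : ℝ) ^ 2 * ((n₂ : ℝ) ^ 2 - 1)) / 30000 - (101 / 5000 : ℝ) * n₁ * n₂ * ((n₁ : ℝ) + n₂) ≤ ‖X ((n₁ : ℤ) • e + (n₂ : ℤ) • e')‖ ^ 2 := by
  intro S X h0 hgood hch hX e e' he he' he0 he0' hi n₁ n₂
  have hc0 : ((n₁ : ℤ) • e).1 = 0 := by simp [he0]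
  have hne : -e ∈ hcpStarIdx := neg_mem_hcpStarIdx he he0
  have hne0 : (-e).1 = 0 := by simp [he0]
  obtain ⟨hPb, hPdd⟩ := farIn_line h0 hgood hch hX hc0 hne hne0
  obtain ⟨hQb, hQdd⟩ := farIn_line h0 hgood hch hX hc0 he' he0'
  have hPn : X ((n₁ : ℤ) • e + ((n₁ : ℕ) : ℤ) • -e) = 0 := by
    rw [show (n₁ : ℤ) • e + ((n₁ : ℕ) : ℤ) • -e = 0 by module]
    exact hX.1
  have hPQ : X ((n₁ : ℤ) • e + ((0 : ℕ) : ℤ) • -e) = X ((n₁ : ℤ) • e + ((0 : ℕ) : ℤ) • e') := by simp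
  have hcor : 0 < n₁ → 0 < n₂ → 3843 / 10000 ≤
      ⟪X ((n₁ : ℤ) • e + ((0 : ℕ) : ℤ) • -e) - X ((n₁ : ℤ) • e + ((1 : ℕ) : ℤ) • -e),
        X ((n₁ : ℤ) • e + ((1 : ℕ) : ℤ) • e') - X ((n₁ : ℤ) • e + ((0 : ℕ) : ℤ) • e')⟫ := by
    intro _ _
    simp only [Nat.cast_zero, Nat.cast_one, zero_smul, one_smul, add_zero]
    exact farIn_corner hgood hch hX hc0 he he' he0 hi
  exact farIn_assemble (fun t : ℕ => X ((n₁ : ℤ) • e + (t : ℤ) • -e))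
    (fun t : ℕ => X ((n₁ : ℤ) • e + (t : ℤ) • e')) n₁ n₂ hPn hPQ hPb hPdd hQb hQdd hcor

end Summit.AtomisticToContinuum.Crystallization.Theorems.PalmUnimodularRigidity.LayeredLawsSelectHcp

end
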